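import Mathlib
import Summits.NavierStokesRegularity.FluidComputer.SkewCutGalerkinSections
import Summits.NavierStokesRegularity.FluidComputer.BorderedHeadTailBound

/-!
# THEOREM 3-B-NESTED: the row hypotheses FROM MATRIX DATA (diagonal / Hilbert-basis setting) —
head truncation in coordinates, the bordered Galerkin matrix, the head inverse from its matrix inverse
(profile-cert-3 g5, cell `ns-blowup`, 2026-08-26)

HONEST FRAMING (human rulings D-0035/D-0074): nothing here is a claim about Navier–Stokes blow-up.
WHAT THIS IS NOT: not NS evidence. MODEL lane bookkeeping about the FORMAT of the F5 eigenpair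
certificates of GROUP B (`CertificateAbcSpectrum*`, three implementations; cap `SKEWCUT-PAIR.md` §9
(N1)–(N7)). `BorderedEigenpairMasterNested.certified_eigenpair_of_row_nested` (p456694) takes the
3-B-NESTED row in OPERATOR form: resolvent coordinates `R = 1 − T − (x₀ − λ̃)S₀` on a Hilbert space,
a head `U` with `S₀ U ⊆ U`, `S₀ Uᗮ ⊆ Uᗮ`, a linear LEFT inverse `Ainv` of the nested bordered head
`(u, m) ↦ (P R u + m P ṽ, ⟪v_r, S₀ u⟫)` with constants `α, β_B, β_C′`, and the tail coercivity. This file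
is the dictionary to what the certifiers hold — MATRICES in a basis — in the diagonal setting of
`SkewCutGalerkinSections` (instab4, the UNBORDERED twin): `b` a Hilbert basis, `S₀ = diag(d)` with
`d_i (x₀ − ℓ_i) = 1`, head `U_K` = span of the basis vectors indexed by a FINITE set `K` (the cube),
first-order part `T` with matrix `t_ij = ⟪b i, T b j⟫` and `a_ij := t_ij (x₀ − ℓ_j)` (the certifiers'
first-order matrix), unknowns measured by `v = S₀ u` (coordinates `c_j = ⟪b j, S₀ u⟫`).

* §1 coordinates of the head truncation: `P_K x = Σ_{i∈K} ⟪b i, x⟫ b i`, `x ∈ U_Kᗮ ↔` head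
  coordinates vanish, `diag` preserves `U_Kᗮ`, every `b i` is in `U_K` or in `U_Kᗮ`,
  `‖y‖² = Σ_{i∈K} |⟪b i, y⟫|²` on `U_K`;
* §2 the resolvent-coordinate operator on head vectors: for `u = Σ_{j∈K} ((x₀ − ℓ_j) c_j) b_j`
  (so `S₀ u = Σ_{j∈K} c_j b_j`), `⟪b i, R u⟫ = [i ∈ K](λ̃ − ℓ_i) c_i − Σ_{j∈K} a_ij c_j` — the HEAD
  block is the Galerkin matrix `λ̃ − L_K`, `L_K = [ℓ δ + a]_{K×K}`, the LEAK `(1 − P) R u` is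
  `−[a]_{Kᶜ×K} c` (`C_K` of the certificates);
* §3 the head inverse: a linear left inverse `Binv` of the BORDERED GALERKIN MATRIX
  `𝔅_K (c, m) = ((λ̃ − L_K) c + m v̂, Σ_{i∈K} conj(r_i) c_i)` (`v̂_i = ⟪b i, ṽ⟫` the head part of the
  column `ṽ_h`, `r_i = ⟪b i, v_r⟫` the row) yields the operator-form `Ainv` of p456694 with `hAleft`
  (`exists_nestedHeadInverse_of_matrix`), acting in coordinates by
  `S₀ (Ainv (y, g)).1 = Σ_{j∈K} (Binv (ŷ, g)).1 j • b j`;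
* §4 `hαb` from `‖Binv‖_{ℓ²(K) ⊕₂ 𝕜} ≤ α` (`head_alpha_bound_of_matrix`; the certified `α₀`).

The two remaining head constants (`β_B`: head response to the tail through the band; nested `β_C′`:
leak + `ṽ_t` column) and the tail form need the BAND of `t` and are treated in the companion file
`BorderedEigenpairSectionsBand`. What stays model-specific after both: that the certifiers' matrices
ARE `[ℓ δ + a]` in the class-II Craya / orbit-pair basis (definitions; instab3 `AbcCrayaFrames`) and
the transcribed numbers (certifier audit) — the same residue list as GROUP A's X0 chain (instab4
KERNEL-CHAIN §4).

Mathlib + `SkewCutGalerkinSections` (p445411) + `BorderedHeadTailBound` (p453671); no new definitions.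
bears_on LADDER-NS N5 / Z4-a(1)(2); evidence-only for `EpisodeBase` (stmt-NavierStokesRegularity-19179).
[folklore] throughout (finite-dimensional linear algebra in a Hilbert basis).
-/

noncomputable section

namespace Summit.NavierStokesRegularity.FluidComputer.BorderedEigenpairSections

open Submodule
open scoped InnerProductSpace ComplexConjugate

variable {𝕜 H : Type*} [RCLike 𝕜] [NormedAddCommGroup H] [InnerProductSpace 𝕜 H]
variable {ι : Type*} (b : HilbertBasis ι 𝕜 H)

/-! ## §1 Coordinates of the head truncation `U_K` (finite `K`) -/

/-- `x ∈ U_Kᗮ` iff the head coordinates of `x` vanish. -/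
theorem mem_orthogonal_closure_span_iff (K : Finset ι) (x : H) :
    x ∈ ((span 𝕜 (b '' (K : Set ι))).topologicalClosure)ᗮ ↔ ∀ i ∈ K, ⟪b i, x⟫_𝕜 = 0 := by
  constructor
  · intro hx i hi
    exact inner_right_of_mem_orthogonal
      ((span 𝕜 (b '' (K : Set ι))).le_topologicalClosure (subset_span ⟨i, hi, rfl⟩)) hx
  · intro h
    rw [mem_orthogonal]
    intro u hu
    rw [HilbertBasis.mem_topologicalClosure_span_image_iff] at hu
    have hsum := b.hasSum_inner_mul_inner u x
    have h0 : (fun i => ⟪u, b i⟫_𝕜 * ⟪b i, x⟫_𝕜) = fun _ => 0 := by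
      funext i
      by_cases hi : i ∈ K
      · rw [h i hi, mul_zero]
      · have : ⟪u, b i⟫_𝕜 = 0 := by
          rw [← inner_conj_symm, ← b.repr_apply_apply, hu i (by simpa using hi), map_zero]
        rw [this, zero_mul]
    rw [h0] at hsum
    exact hsum.unique hasSum_zero


/-- The star projection onto the head truncation is the coordinate truncation:
`P_K x = Σ_{i∈K} ⟪b i, x⟫ • b i`. -/
theorem starProjection_closure_span_eq_sum [CompleteSpace H] [DecidableEq ι] (K : Finset ι) (x : H) :
    (span 𝕜 (b '' (K : Set ι))).topologicalClosure.starProjection x = ∑ i ∈ K, ⟪b i, x⟫_𝕜 • b i := by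
  refine eq_starProjection_of_mem_orthogonal ?_ ?_
  · exact (span 𝕜 (b '' (K : Set ι))).le_topologicalClosure
      (sum_mem fun i hi => smul_mem _ _ (subset_span ⟨i, hi, rfl⟩))
  · rw [mem_orthogonal_closure_span_iff]
    intro i hi
    rw [inner_sub_right, SkewCutGalerkinSections.inner_basis_sum_smul b K (fun j => ⟪b j, x⟫_𝕜) i,
      if_pos hi, sub_self]

/-- Head coordinates of the star projection: `⟪b i, P_K x⟫ = [i ∈ K] ⟪b i, x⟫`. -/
theorem inner_basis_starProjection [CompleteSpace H] [DecidableEq ι] (K : Finset ι) (x : H) (i : ι) :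
    ⟪b i, (span 𝕜 (b '' (K : Set ι))).topologicalClosure.starProjection x⟫_𝕜 =
      if i ∈ K then ⟪b i, x⟫_𝕜 else 0 := by
  rw [starProjection_closure_span_eq_sum, SkewCutGalerkinSections.inner_basis_sum_smul]

/-- Every basis vector lies in the head `U_K` or in `U_Kᗮ` (the hypothesis `hhead` of
`SkewCutGalerkinTailForm.tail_coercive_of_structure`). -/
theorem basis_mem_or_mem_orthogonal [CompleteSpace H] (K : Finset ι) (i : ι) :
    b i ∈ (span 𝕜 (b '' (K : Set ι))).topologicalClosure ∨
      b i ∈ ((span 𝕜 (b '' (K : Set ι))).topologicalClosure)ᗮ := by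
  by_cases hi : i ∈ K
  · exact Or.inl ((span 𝕜 (b '' (K : Set ι))).le_topologicalClosure (subset_span ⟨i, hi, rfl⟩))
  · exact Or.inr (SkewCutGalerkinSections.basis_mem_orthogonal_closure_span b K hi)

/-- A bounded diagonal operator preserves `U_Kᗮ` (the hypothesis `hS₀U'` of p456694; `hS₀U` is
instab4's `SkewCutGalerkinPerturbation.diagonalCLM_mem_closure_span`). -/
theorem diagonalCLM_mem_orthogonal_closure_span (m : lp (fun _ : ι => 𝕜) ⊤) (K : Finset ι) {x : H}
    (hx : x ∈ ((span 𝕜 (b '' (K : Set ι))).topologicalClosure)ᗮ) :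
    b.diagonalCLM m x ∈ ((span 𝕜 (b '' (K : Set ι))).topologicalClosure)ᗮ := by
  rw [mem_orthogonal_closure_span_iff] at hx ⊢
  intro i hi
  rw [← b.repr_apply_apply, b.diagonalCLM_apply_repr, b.repr_apply_apply, hx i hi, mul_zero]

/-- A vector of the head is the finite combination of its head coordinates. -/
theorem eq_sum_of_mem_closure_span [CompleteSpace H] [DecidableEq ι] (K : Finset ι) {y : H}
    (hy : y ∈ (span 𝕜 (b '' (K : Set ι))).topologicalClosure) :
    y = ∑ i ∈ K, ⟪b i, y⟫_𝕜 • b i := by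
  rw [← starProjection_closure_span_eq_sum b K y]
  exact (starProjection_eq_self_iff.mpr hy).symm

/-- Parseval on the head: `‖y‖² = Σ_{i∈K} |⟪b i, y⟫|²` for `y ∈ U_K`. -/
theorem norm_sq_eq_sum_of_mem_closure_span [CompleteSpace H] [DecidableEq ι] (K : Finset ι) {y : H}
    (hy : y ∈ (span 𝕜 (b '' (K : Set ι))).topologicalClosure) :
    ‖y‖ ^ 2 = ∑ i ∈ K, ‖⟪b i, y⟫_𝕜‖ ^ 2 := by
  conv_lhs => rw [eq_sum_of_mem_closure_span b K hy]
  exact SkewCutGalerkinSections.norm_sq_sum_smul_basis b K _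

/-- Bessel on a finite index set: `Σ_{i∈F} |⟪b i, x⟫|² ≤ ‖x‖²`. -/
theorem sum_norm_sq_inner_le (F : Finset ι) (x : H) : ∑ i ∈ F, ‖⟪b i, x⟫_𝕜‖ ^ 2 ≤ ‖x‖ ^ 2 :=
  b.orthonormal.sum_inner_products_le x

/-- Parseval with finite support: if the coordinates of `x` vanish off a finite `F`, then
`‖x‖² = Σ_{i∈F} |⟪b i, x⟫|²`. -/
theorem norm_sq_eq_sum_of_support [CompleteSpace H] [DecidableEq ι] (F : Finset ι) {x : H}
    (hx : ∀ i, i ∉ F → ⟪b i, x⟫_𝕜 = 0) : ‖x‖ ^ 2 = ∑ i ∈ F, ‖⟪b i, x⟫_𝕜‖ ^ 2 := by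
  have hxU : x ∈ (span 𝕜 (b '' (F : Set ι))).topologicalClosure := by
    rw [HilbertBasis.mem_topologicalClosure_span_image_iff]
    intro i hi
    rw [b.repr_apply_apply]
    exact hx i (by simpa using hi)
  exact norm_sq_eq_sum_of_mem_closure_span b F hxU

/-! ## §2 The resolvent-coordinate operator on head vectors, in the `v = S₀ u` measure -/

section Head

variable [DecidableEq ι] (ℓ : ι → ℝ) (x₀ : ℝ) (d : lp (fun _ : ι => 𝕜) ⊤)

/-- The head vector with `v`-coordinates `c`: `u = Σ_{j∈K} ((x₀ − ℓ_j) c_j) b_j` lies in `U_K` and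
`S₀ u = Σ_{j∈K} c_j b_j` (`d_j (x₀ − ℓ_j) = 1`). -/
theorem headVector_mem_and_diag [CompleteSpace H] (hd : ∀ i, d i * ((x₀ : 𝕜) - (ℓ i : 𝕜)) = 1)
    (K : Finset ι) (c : ι → 𝕜) :
    (∑ j ∈ K, (((x₀ : 𝕜) - (ℓ j : 𝕜)) * c j) • b j) ∈
        (span 𝕜 (b '' (K : Set ι))).topologicalClosure ∧
      b.diagonalCLM d (∑ j ∈ K, (((x₀ : 𝕜) - (ℓ j : 𝕜)) * c j) • b j) = ∑ j ∈ K, c j • b j := by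
  refine ⟨(span 𝕜 (b '' (K : Set ι))).le_topologicalClosure
    (sum_mem fun j hj => smul_mem _ _ (subset_span ⟨j, hj, rfl⟩)), ?_⟩
  apply b.repr.injective
  ext i
  rw [b.diagonalCLM_apply_repr, b.repr_apply_apply, b.repr_apply_apply,
    SkewCutGalerkinSections.inner_basis_sum_smul, SkewCutGalerkinSections.inner_basis_sum_smul]
  split_ifs with hi
  · rw [← mul_assoc, hd, one_mul]
  · rw [mul_zero]

/-- **Coordinates of `R u` for a head vector** (`R = 1 − T − (x₀ − λ̃) S₀`, `a_ij = t_ij (x₀ − ℓ_j)`,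
`t_ij = ⟪b i, T b j⟫`): `⟪b i, R u⟫ = [i ∈ K] (λ̃ − ℓ_i) c_i − Σ_{j∈K} a_ij c_j` for
`u = Σ_{j∈K} ((x₀ − ℓ_j) c_j) b_j`. On the head this is the Galerkin matrix `λ̃ − L_K`
(`L_K = [ℓ δ + a]_{K×K}`), off the head it is the LEAK `−[a]_{Kᶜ × K}` — independent of `x₀`. -/
theorem inner_basis_resolventCoord_headVector [CompleteSpace H]
    (hd : ∀ i, d i * ((x₀ : 𝕜) - (ℓ i : 𝕜)) = 1)
    (T : H →L[𝕜] H) (lt : 𝕜) (K : Finset ι) (c : ι → 𝕜) (i : ι) :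
    ⟪b i, ((1 : H →L[𝕜] H) - T - ((x₀ : 𝕜) - lt) • b.diagonalCLM d)
        (∑ j ∈ K, (((x₀ : 𝕜) - (ℓ j : 𝕜)) * c j) • b j)⟫_𝕜 =
      (if i ∈ K then (lt - (ℓ i : 𝕜)) * c i else 0) -
        ∑ j ∈ K, (⟪b i, T (b j)⟫_𝕜 * ((x₀ : 𝕜) - (ℓ j : 𝕜))) * c j := by
  have hS := (headVector_mem_and_diag b ℓ x₀ d hd K c).2
  simp only [sub_apply, FunLike.coe_smul, Pi.smul_apply, one_apply_eq_self]
  rw [hS, inner_sub_right, inner_sub_right, inner_smul_right,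
    SkewCutGalerkinSections.inner_basis_sum_smul, SkewCutGalerkinSections.inner_basis_sum_smul,
    map_sum, inner_sum]
  have hT : ∑ j ∈ K, ⟪b i, T ((((x₀ : 𝕜) - (ℓ j : 𝕜)) * c j) • b j)⟫_𝕜 =
      ∑ j ∈ K, (⟪b i, T (b j)⟫_𝕜 * ((x₀ : 𝕜) - (ℓ j : 𝕜))) * c j :=
    Finset.sum_congr rfl fun j _ => by rw [map_smul, inner_smul_right]; ring
  rw [hT]
  split_ifs with hi
  · ring
  · ring

end Head

/-! ## §3 The head inverse of the nested bordered head from the inverse of the bordered Galerkin matrix -/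

section HeadInverse

variable [DecidableEq ι] (ℓ : ι → ℝ) (x₀ : ℝ) (d : lp (fun _ : ι => 𝕜) ⊤)

/-- `v`-coordinates of a head vector: for `u ∈ U_K`, `u = Σ_{j∈K} ((x₀ − ℓ_j) c_j) b_j` with
`c_j = ⟪b j, S₀ u⟫`. -/
theorem eq_headVector_of_mem [CompleteSpace H] (hd : ∀ i, d i * ((x₀ : 𝕜) - (ℓ i : 𝕜)) = 1)
    (K : Finset ι) {u : H} (hu : u ∈ (span 𝕜 (b '' (K : Set ι))).topologicalClosure) :
    u = ∑ j ∈ K, (((x₀ : 𝕜) - (ℓ j : 𝕜)) * ⟪b j, b.diagonalCLM d u⟫_𝕜) • b j := by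
  conv_lhs => rw [eq_sum_of_mem_closure_span b K hu]
  refine Finset.sum_congr rfl fun j _ => ?_
  rw [← b.repr_apply_apply (b.diagonalCLM d u), b.diagonalCLM_apply_repr, b.repr_apply_apply,
    ← mul_assoc, mul_comm ((x₀ : 𝕜) - (ℓ j : 𝕜)), hd, one_mul]

/-- **The operator-form head inverse from the matrix inverse.** Diagonal setting (`S₀ = diag(d)`,
`d_i (x₀ − ℓ_i) = 1`), head `U_K` (`K` finite) with star projection `P`, `R = 1 − T − (x₀ − λ̃) S₀`,
`a_ij = ⟪b i, T b j⟫ (x₀ − ℓ_j)`; column vector `ṽ` (arbitrary; head part `v̂_i = ⟪b i, ṽ⟫`), row vector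
`v_r ∈ U_K` (`r_i = ⟪b i, v_r⟫`). Let `Binv` be a linear LEFT INVERSE of the bordered Galerkin matrix
`𝔅_K (c, m) = ( ((λ̃ − ℓ_i) c_i − Σ_{j∈K} a_ij c_j + m v̂_i)_{i∈K} , Σ_{i∈K} conj(r_i) c_i )` on
`(K → 𝕜) × 𝕜`. Then there is a linear `Ainv` on `H × 𝕜`, acting by
`Ainv (y, g) = (Σ_{j∈K} ((x₀ − ℓ_j) z_j) b_j, ζ)` with `(z, ζ) = Binv ((⟪b i, y⟫)_{i∈K}, g)` (so
`S₀ (Ainv (y, g)).1 = Σ_{j∈K} z_j b_j`, values in the head), which is a LEFT inverse of the nested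
bordered head: `Ainv (P (R u) + m • P ṽ, ⟪v_r, S₀ u⟫) = (u, m)` for `u ∈ U_K` — the data `Ainv`,
`hAleft` of `BorderedEigenpairMasterNested.certified_eigenpair_of_row_nested`. -/
theorem exists_nestedHeadInverse_of_matrix [CompleteSpace H]
    (hd : ∀ i, d i * ((x₀ : 𝕜) - (ℓ i : 𝕜)) = 1) (T : H →L[𝕜] H) (lt : 𝕜) (K : Finset ι)
    (vc vr : H) (hvr : vr ∈ (span 𝕜 (b '' (K : Set ι))).topologicalClosure)
    (Binv : ((K → 𝕜) × 𝕜) →ₗ[𝕜] ((K → 𝕜) × 𝕜))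
    (hBinv : ∀ (c : K → 𝕜) (m : 𝕜),
      Binv (fun i : K => (lt - (ℓ i : 𝕜)) * c i -
          ∑ j : K, (⟪b i, T (b j)⟫_𝕜 * ((x₀ : 𝕜) - (ℓ j : 𝕜))) * c j + m * ⟪b i, vc⟫_𝕜,
        ∑ i : K, conj ⟪b i, vr⟫_𝕜 * c i) = (c, m)) :
    ∃ Ainv : (H × 𝕜) →ₗ[𝕜] (H × 𝕜),
      (∀ (y : H) (g : 𝕜),
        (Ainv (y, g)).1 = ∑ j : K, (((x₀ : 𝕜) - (ℓ j : 𝕜)) *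
            (Binv (fun i : K => ⟪b i, y⟫_𝕜, g)).1 j) • b j ∧
          (Ainv (y, g)).2 = (Binv (fun i : K => ⟪b i, y⟫_𝕜, g)).2) ∧
      (∀ (y : H) (g : 𝕜), (Ainv (y, g)).1 ∈ (span 𝕜 (b '' (K : Set ι))).topologicalClosure ∧
        b.diagonalCLM d (Ainv (y, g)).1 = ∑ j : K, (Binv (fun i : K => ⟪b i, y⟫_𝕜, g)).1 j • b j) ∧
      (∀ u ∈ (span 𝕜 (b '' (K : Set ι))).topologicalClosure, ∀ m : 𝕜,
        Ainv ((span 𝕜 (b '' (K : Set ι))).topologicalClosure.starProjection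
              (((1 : H →L[𝕜] H) - T - ((x₀ : 𝕜) - lt) • b.diagonalCLM d) u) +
            m • (span 𝕜 (b '' (K : Set ι))).topologicalClosure.starProjection vc,
          ⟪vr, b.diagonalCLM d u⟫_𝕜) = (u, m)) := by
  set U := (span 𝕜 (b '' (K : Set ι))).topologicalClosure with hU
  set S₀ := b.diagonalCLM d with hS₀
  set R : H →L[𝕜] H := (1 : H →L[𝕜] H) - T - ((x₀ : 𝕜) - lt) • S₀ with hR
  -- coordinates and synthesis as linear maps
  let coords : H →ₗ[𝕜] (K → 𝕜) :=
    LinearMap.pi fun i : K => ((innerSL 𝕜 (b (i : ι)) : H →L[𝕜] 𝕜) : H →ₗ[𝕜] 𝕜)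
  have hcoords : ∀ (y : H) (i : K), coords y i = ⟪b i, y⟫_𝕜 := fun y i => by
    simp [coords, LinearMap.pi_apply]
  let synth : (K → 𝕜) →ₗ[𝕜] H :=
    { toFun := fun c => ∑ j : K, (((x₀ : 𝕜) - (ℓ j : 𝕜)) * c j) • b (j : ι)
      map_add' := fun c c' => by
        rw [← Finset.sum_add_distrib]
        exact Finset.sum_congr rfl fun j _ => by rw [Pi.add_apply, mul_add, add_smul]
      map_smul' := fun k c => by
        rw [RingHom.id_apply, Finset.smul_sum]
        exact Finset.sum_congr rfl fun j _ => by
          rw [Pi.smul_apply, smul_eq_mul, smul_smul, mul_left_comm] }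
  have hsynth : ∀ c : K → 𝕜, synth c = ∑ j : K, (((x₀ : 𝕜) - (ℓ j : 𝕜)) * c j) • b (j : ι) :=
    fun c => rfl
  let Ainv : (H × 𝕜) →ₗ[𝕜] (H × 𝕜) :=
    (synth.prodMap LinearMap.id) ∘ₗ Binv ∘ₗ (coords.prodMap LinearMap.id)
  have hAinv : ∀ (y : H) (g : 𝕜), Ainv (y, g) =
      (synth (Binv (fun i : K => ⟪b i, y⟫_𝕜, g)).1, (Binv (fun i : K => ⟪b i, y⟫_𝕜, g)).2) := by
    intro y g
    have hc : coords y = fun i : K => ⟪b i, y⟫_𝕜 := funext (hcoords y)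
    simp only [Ainv, LinearMap.coe_comp, Function.comp_apply, LinearMap.prodMap_apply,
      LinearMap.id_coe, id_eq, hc]
  -- a `v`-coordinate vector on `K` extended by zero, and the two sums over `K`
  have hext : ∀ (z : K → 𝕜), ∑ j : K, (((x₀ : 𝕜) - (ℓ j : 𝕜)) * z j) • b (j : ι) =
      ∑ j ∈ K, (((x₀ : 𝕜) - (ℓ j : 𝕜)) * (fun i : ι => if h : i ∈ K then z ⟨i, h⟩ else 0) j) • b j := by
    intro z
    rw [← Finset.sum_coe_sort K]
    refine Finset.sum_congr rfl fun j _ => ?_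
    simp only [dif_pos j.2]
  refine ⟨Ainv, fun y g => ?_, fun y g => ?_, fun u hu m => ?_⟩
  · rw [hAinv]
    exact ⟨rfl, rfl⟩
  · rw [hAinv]
    dsimp only
    rw [hsynth, hext]
    have h := headVector_mem_and_diag b ℓ x₀ d hd K
      (fun i : ι => if h : i ∈ K then (Binv (fun i : K => ⟪b i, y⟫_𝕜, g)).1 ⟨i, h⟩ else 0)
    refine ⟨h.1, ?_⟩
    rw [hS₀, h.2, ← Finset.sum_coe_sort K]
    refine Finset.sum_congr rfl fun j _ => ?_
    simp only [dif_pos j.2]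
  · -- the `v`-coordinates of `u`
    set c : K → 𝕜 := fun j => ⟪b j, S₀ u⟫_𝕜 with hc
    set c' : ι → 𝕜 := fun j => ⟪b j, S₀ u⟫_𝕜 with hc'
    have huc : u = ∑ j ∈ K, (((x₀ : 𝕜) - (ℓ j : 𝕜)) * c' j) • b j :=
      eq_headVector_of_mem b ℓ x₀ d hd K hu
    -- head coordinates of the datum
    have hfirst : (fun i : K => ⟪b i, U.starProjection (R u) + m • U.starProjection vc⟫_𝕜) =
        fun i : K => (lt - (ℓ i : 𝕜)) * c i -
          ∑ j : K, (⟪b i, T (b j)⟫_𝕜 * ((x₀ : 𝕜) - (ℓ j : 𝕜))) * c j + m * ⟪b i, vc⟫_𝕜 := by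
      funext i
      rw [inner_add_right, inner_smul_right, inner_basis_starProjection, if_pos i.2,
        inner_basis_starProjection, if_pos i.2]
      conv_lhs => rw [huc, hR, hS₀]
      rw [inner_basis_resolventCoord_headVector b ℓ x₀ d hd T lt K c' i, if_pos i.2,
        ← Finset.sum_coe_sort K]
    have hsecond : ⟪vr, S₀ u⟫_𝕜 = ∑ i : K, conj ⟪b i, vr⟫_𝕜 * c i := by
      conv_lhs => rw [eq_sum_of_mem_closure_span b K hvr]
      rw [sum_inner, ← Finset.sum_coe_sort K]
      refine Finset.sum_congr rfl fun i _ => ?_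
      rw [inner_smul_left]
    rw [hAinv, hfirst, hsecond, hBinv c m]
    dsimp only
    rw [hsynth, Finset.sum_coe_sort K (fun j => (((x₀ : 𝕜) - (ℓ j : 𝕜)) * c' j) • b j), ← huc]

end HeadInverse

/-! ## §4 The head constant `α` from the matrix norm of `Binv` -/

section Alpha

variable [DecidableEq ι]

/-- Parseval for a combination indexed by the head: `‖Σ_{j : K} z_j b_j‖² = Σ_{j : K} |z_j|²`. -/
theorem norm_sq_sum_univ_smul_basis (K : Finset ι) (z : K → 𝕜) :
    ‖∑ j : K, z j • b (j : ι)‖ ^ 2 = ∑ j : K, ‖z j‖ ^ 2 := by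
  have h1 : ∑ j : K, z j • b (j : ι) =
      ∑ j ∈ K, (fun i : ι => if h : i ∈ K then z ⟨i, h⟩ else 0) j • b j := by
    rw [← Finset.sum_coe_sort K]
    exact Finset.sum_congr rfl fun j _ => by simp only [dif_pos j.2]
  rw [h1, SkewCutGalerkinSections.norm_sq_sum_smul_basis, ← Finset.sum_coe_sort K]
  exact Finset.sum_congr rfl fun j _ => by simp only [dif_pos j.2]

/-- `Σ_{i : K} |⟪b i, y⟫|² = ‖y‖²` on the head. -/
theorem sum_univ_norm_sq_inner_eq [CompleteSpace H] (K : Finset ι) {y : H}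
    (hy : y ∈ (span 𝕜 (b '' (K : Set ι))).topologicalClosure) :
    ∑ i : K, ‖⟪b (i : ι), y⟫_𝕜‖ ^ 2 = ‖y‖ ^ 2 := by
  rw [norm_sq_eq_sum_of_mem_closure_span b K hy, ← Finset.sum_coe_sort K]

/-- **The head constant `α` (`hαb` of p456694) from the matrix norm of `Binv`.** If `Ainv` acts in
coordinates through `Binv` (`S₀ (Ainv (y, g)).1 = Σ_{j∈K} z_j b_j`, `(Ainv (y, g)).2 = ζ`,
`(z, ζ) = Binv (ŷ, g)`, `ŷ_i = ⟪b i, y⟫` — the shape delivered by `exists_nestedHeadInverse_of_matrix`)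
and `‖Binv (c, g)‖² ≤ α² ‖(c, g)‖²` in `ℓ²(K) ⊕₂ 𝕜` (the certified `α₀ ≥ ‖Â₀⁻¹‖₂`, e.g. from
`θ = ‖1 − X̃Â₀‖ < 1`, `α₀ = ‖X̃‖/(1 − θ)`), then
`‖(S₀ (Ainv (y, g)).1, (Ainv (y, g)).2)‖ ≤ α ‖(y, g)‖` for `y ∈ U_K`. -/
theorem head_alpha_bound_of_matrix [CompleteSpace H] (S₀ : H →L[𝕜] H) (K : Finset ι)
    (Binv : ((K → 𝕜) × 𝕜) →ₗ[𝕜] ((K → 𝕜) × 𝕜)) (Ainv : (H × 𝕜) →ₗ[𝕜] (H × 𝕜))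
    (hA1 : ∀ (y : H) (g : 𝕜),
      S₀ (Ainv (y, g)).1 = ∑ j : K, (Binv (fun i : K => ⟪b i, y⟫_𝕜, g)).1 j • b j)
    (hA2 : ∀ (y : H) (g : 𝕜), (Ainv (y, g)).2 = (Binv (fun i : K => ⟪b i, y⟫_𝕜, g)).2)
    {α : ℝ} (hα : 0 ≤ α)
    (hB : ∀ (c : K → 𝕜) (g : 𝕜),
      ∑ j : K, ‖(Binv (c, g)).1 j‖ ^ 2 + ‖(Binv (c, g)).2‖ ^ 2 ≤
        α ^ 2 * (∑ i : K, ‖c i‖ ^ 2 + ‖g‖ ^ 2)) :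
    ∀ y ∈ (span 𝕜 (b '' (K : Set ι))).topologicalClosure, ∀ g : 𝕜,
      ‖WithLp.toLp 2 (S₀ (Ainv (y, g)).1, (Ainv (y, g)).2)‖ ≤ α * ‖WithLp.toLp 2 (y, g)‖ := by
  intro y hy g
  have h2 : ‖WithLp.toLp 2 (S₀ (Ainv (y, g)).1, (Ainv (y, g)).2)‖ ^ 2 ≤
      (α * ‖WithLp.toLp 2 (y, g)‖) ^ 2 := by
    rw [BorderedHeadTailBound.norm_toLp_sq, mul_pow, BorderedHeadTailBound.norm_toLp_sq, hA1, hA2,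
      norm_sq_sum_univ_smul_basis, ← sum_univ_norm_sq_inner_eq b K hy]
    exact hB _ g
  exact (pow_le_pow_iff_left₀ (norm_nonneg _) (by positivity) two_ne_zero).mp h2

end Alpha

end Summit.NavierStokesRegularity.FluidComputer.BorderedEigenpairSections

end
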